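import Summits.QuantumFields.YangMills.Theorems.BalabanUVNodesN15TwoSpacingGluingLocality
import HarnessLib

/-!
# N15 = NE2, road (c) — PROGRAMME (PC), towards (PC-B) «`(Q′G′²Q′*)⁻¹(U)` per cube»: WALK LOCALITY OF GLUED INVERSES WITH CLOSE (NOT EQUAL) NEAR DATA — two knits whose cube pieces
# are ε-CLOSE on the near cubes and arbitrary on the far ones differ by `≤ (C_nearε + C_far e^{−ρd_Z(y)})·e^{−ρ′d}` (n15-c∕279 generalized; dag-n15-c g27, n15-c∕289)

Cell `pub-ymgap`, seat `pub-ymgap-dag-n15-c` (generation g27; R134 (a), s1; HUMAN RULING D-0062).  `bears_on: R4∕N15 · K3⁸ SpineGivenEndpointR13SepCoPHV (stmt-QuantumFields-27366)`;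
filed `--kind proof --supports stmt-QuantumFields-27366 --as helper` — COUNT-NEUTRAL.  Pure block-majorant algebra (B11SectG currency); 0 `def`, 0 `sorry`.  Imports n15-c∕279
`…TwoSpacingGluingLocality` (`glueInv_sub_glueInv`, `hasMaj_comp_farOut`, `hasMaj_outLoc_comp_exp`, `ind_le_exp_dZ`, `hasMaj_sum_far`).  Nothing in the tree is modified.

WHY (see HOME/PCB-DESIGN-g27.md).  For `(Q′G′²Q′*)⁻¹` per cube the local model at cube `k` is the FLAT `S(1)` in a gauge regular on the doubled walk cube; its defect needs
`‖(G′(U^{w_k}) − G′(1))·1_{near k}‖ ≲ r_V + e^{−ρM}` with NO factor `n = L^k`.  Resolvent identities produce the factor `n` off the box; inside the KNIT both Green's functions are glued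
inverses whose cube pieces are `r_V`-CLOSE near `k` (dressed vs undressed flat cube resolvents, small species in the trivial gauge) and unrelated far from `k` — this file's theorem.

WHAT.  §1 ★ `hasMaj_bracket_near`, ★ `hasMaj_bracket_far`: rows of `D∘N + (G₀♭∘N)∘(E∘N♭)` (`N = (1−R)⁻¹`, `N♭ = (1−R♭)⁻¹`) for `D, E` with plain small rows resp. OUTPUT-LOCALIZED rows on
`Z`; ★★★ `hasMaj_glueInv_sub_glueInv_near`: `G₀ − G₀♭ = D_n + D_f`, `R − R♭ = E_n + E_f` (near parts small: `ε₁`, `θ_n`; far parts `1_Z(y)`-localized: `a₁`, `θ₁`) ⟹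
`glueInv G₀ R − glueInv G₀♭ R♭ ≤ [(ε₁ + A N_c θ_n c_r)N_c + (a₁ + A N_c θ₁ c_r)N_c·e^{−(δ∕2−σ)d_Z(y)}]·e^{−(δ∕2−2σ)d}`, `N_c = (1 − θc_r)⁻¹c_r`.  §2 ★★★ `hasMaj_glueInv_sub_glueInv_of_close_pieces`
(cube pieces: `P_□ − P♭_□ ≤ 1_S1_S·ε_Pe^{−δd}` and `Q_□ − Q♭_□ ≤ 1_S1_S·ε_Qe^{−δd}` on the cubes NOT `Far`, the usual rows everywhere, `S_□ ⊆ Z` on the far cubes); ★★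
`hasMaj_glued_sub_glued_of_close_cubes` (FILE 45's cube pairs: `G_□ − G♭_□` and `[Δ,M_h]G_□ − [Δ♭,M_h]G♭_□` close off the far cubes).

HONEST FRAMING ∕ LIMITS.  Algebra of glued inverses; no propagator is estimated; [B9] Cor. 3.8 ∕ Thm 3.14 cited for the MECHANISM only.  NE2⁺ NOT PRINTED, NOT proved; N15 of record
untouched; K3⁸ OPEN; counts UNMOVED.  Restate-immune (no Theses import).
-/

noncomputable section

open scoped BigOperators Matrix
open Finset

namespace Summit.QuantumFields.YangMills.BalabanUVNodes.N15.Gluing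

open Literature.MathematicalPhysics.QuantumFieldTheory.Balaban1983to89
open Literature.MathematicalPhysics.QuantumFieldTheory.Balaban1983to89.B11SectG (BlockNorm HasMaj RowSum hasMaj_comp hasMaj_comp_exp conv_exp_le hasMaj_zero)
open Literature.MathematicalPhysics.QuantumFieldTheory.Balaban1983to89.B6RandomWalk (Triangle254)
open Literature.MathematicalPhysics.QuantumFieldTheory.Balaban1983to89.B6Prop26Gluing (mulOp mulOp_apply ind ind_nonneg ind_le_one ind_of_mem ind_of_not_mem)
open Literature.MathematicalPhysics.QuantumFieldTheory.Balaban1983to89.T4EtaRateCoeffDefect (diagK diagK_nonneg hasMaj_mulOp)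

/-! ## §1 The two brackets of the difference formula and the near∕far walk locality -/

section Locality

variable {X : Type} [Fintype X] [DecidableEq X] {g : B6.Geometry} (blk : X → g.Site) (Z : Set g.Site) (dZ : g.Site → ℝ) {σ cr : ℝ}

/-- ★ **THE NEAR BRACKET**: `D ≤ ε₁e^{−δd}`, `E ≤ θ_ne^{−δd}`, `G₀♭ ≤ Ae^{−δd}`, `R, R♭ ≤ θe^{−δd}`, `θc_r < 1`, `4σ ≤ δ` ⟹
`D∘N + (G₀♭∘N)∘(E∘N♭) ≤ (ε₁ + A·N_cθ_n·c_r)·N_c·e^{−(δ−3σ)d}`, `N_c = (1 − θc_r)⁻¹c_r`. [cite: Balaban1984PropagatorsII, (2.91) p.239, (2.135)–(2.136) p.247 (mechanism)] -/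
theorem hasMaj_bracket_near (htri : Triangle254 g) (hd : ∀ a b : g.Site, 0 ≤ g.dist a b) (hd0 : ∀ y : g.Site, g.dist y y = 0) (hrow : RowSum g σ cr) (hσ : 0 ≤ σ) (hcr : 0 ≤ cr)
    {G₀' R R' D E : (X → ℝ) →ₗ[ℝ] (X → ℝ)} {A θ ε₁ θn δ : ℝ} (hA : 0 ≤ A) (hθ : 0 ≤ θ) (hε₁ : 0 ≤ ε₁) (hθn : 0 ≤ θn) (hσδ : 4 * σ ≤ δ)
    (hG₀' : HasMaj (BlockNorm.ofBlocks g blk) (BlockNorm.ofBlocks g blk) G₀' (fun y y' => A * Real.exp (-(δ * g.dist y y'))))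
    (hR : HasMaj (BlockNorm.ofBlocks g blk) (BlockNorm.ofBlocks g blk) R (fun y y' => θ * Real.exp (-(δ * g.dist y y'))))
    (hR' : HasMaj (BlockNorm.ofBlocks g blk) (BlockNorm.ofBlocks g blk) R' (fun y y' => θ * Real.exp (-(δ * g.dist y y'))))
    (hD : HasMaj (BlockNorm.ofBlocks g blk) (BlockNorm.ofBlocks g blk) D (fun y y' => ε₁ * Real.exp (-(δ * g.dist y y'))))
    (hE : HasMaj (BlockNorm.ofBlocks g blk) (BlockNorm.ofBlocks g blk) E (fun y y' => θn * Real.exp (-(δ * g.dist y y'))))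
    (hq : θ * cr < 1) :
    HasMaj (BlockNorm.ofBlocks g blk) (BlockNorm.ofBlocks g blk) (D ∘ₗ neumannR R + G₀' ∘ₗ neumannR R ∘ₗ E ∘ₗ neumannR R')
      (fun y y' => (ε₁ + A * ((1 - θ * cr)⁻¹ * cr) * θn * cr) * ((1 - θ * cr)⁻¹ * cr) * Real.exp (-((δ - 3 * σ) * g.dist y y'))) := by
  have hκ : (BlockNorm.ofBlocks g blk).κ = 1 := rfl
  have hinv : 0 ≤ (1 - θ * cr)⁻¹ := inv_nonneg.2 (by linarith)
  have hN := hasMaj_neumannR blk htri hd hd0 hrow (ρ := δ - σ) hθ (by linarith) (by linarith) hR hq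
  have hN' := hasMaj_neumannR blk htri hd hd0 hrow (ρ := δ - σ) hθ (by linarith) (by linarith) hR' hq
  have h1 := hasMaj_comp_exp (b₁ := BlockNorm.ofBlocks g blk) (b₂ := BlockNorm.ofBlocks g blk) (b₃ := BlockNorm.ofBlocks g blk) (T₁ := D) (T₂ := neumannR R)
    (ρ := δ - 3 * σ) htri hd hrow hε₁ hinv (by linarith) (by linarith) (by linarith) hD hN
  have h2a := hasMaj_comp_exp (b₁ := BlockNorm.ofBlocks g blk) (b₂ := BlockNorm.ofBlocks g blk) (b₃ := BlockNorm.ofBlocks g blk) (T₁ := G₀') (T₂ := neumannR R)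
    (ρ := δ - 2 * σ) htri hd hrow hA hinv (by linarith) (by linarith) (by linarith) hG₀' hN
  have h2b := hasMaj_comp_exp (b₁ := BlockNorm.ofBlocks g blk) (b₂ := BlockNorm.ofBlocks g blk) (b₃ := BlockNorm.ofBlocks g blk) (T₁ := E) (T₂ := neumannR R')
    (ρ := δ - 2 * σ) htri hd hrow hθn hinv (by linarith) (by linarith) (by linarith) hE hN'
  have h2 := hasMaj_comp_exp (b₁ := BlockNorm.ofBlocks g blk) (b₂ := BlockNorm.ofBlocks g blk) (b₃ := BlockNorm.ofBlocks g blk) (T₁ := G₀' ∘ₗ neumannR R)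
    (T₂ := E ∘ₗ neumannR R') (ρ := δ - 3 * σ) htri hd hrow (by rw [hκ]; positivity) (by rw [hκ]; positivity) (by linarith) (by linarith) (by linarith) h2a h2b
  refine ((h1.add h2).congr fun μ => rfl).mono fun y y' => le_of_eq ?_
  rw [hκ]; ring

/-- ★ **THE FAR BRACKET** (n15-c∕279's computation with the two differences abstracted): `D ≤ 1_Z(y)·a₁e^{−δd}`, `E ≤ 1_Z(y)·θ₁e^{−δd}` (OUTPUT-LOCALIZED on `Z`), `G₀♭ ≤ Ae^{−δd}`,
`R, R♭ ≤ θe^{−δd}`, `θc_r < 1`, `4σ ≤ δ`, `d_Z` a minorant of the distance to `Z` ⟹ `D∘N + (G₀♭∘N)∘(E∘N♭) ≤ (a₁ + A·N_cθ₁·c_r)·N_c·e^{−(δ∕2−σ)d_Z(y)}·e^{−(δ∕2−2σ)d}`.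
[cite: Balaban1985BackgroundPropagators, Cor. 3.8 (3.93)–(3.94) p.410 (mechanism)] -/
theorem hasMaj_bracket_far (htri : Triangle254 g) (hd : ∀ a b : g.Site, 0 ≤ g.dist a b) (hd0 : ∀ y : g.Site, g.dist y y = 0) (hrow : RowSum g σ cr) (hσ : 0 ≤ σ) (hcr : 0 ≤ cr)
    (hdZ : ∀ y z, z ∈ Z → dZ y ≤ g.dist y z) {G₀' R R' D E : (X → ℝ) →ₗ[ℝ] (X → ℝ)} {A θ a₁ θ₁ δ : ℝ} (hA : 0 ≤ A) (hθ : 0 ≤ θ) (ha₁ : 0 ≤ a₁) (hθ₁ : 0 ≤ θ₁)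
    (hσδ : 4 * σ ≤ δ)
    (hG₀' : HasMaj (BlockNorm.ofBlocks g blk) (BlockNorm.ofBlocks g blk) G₀' (fun y y' => A * Real.exp (-(δ * g.dist y y'))))
    (hR : HasMaj (BlockNorm.ofBlocks g blk) (BlockNorm.ofBlocks g blk) R (fun y y' => θ * Real.exp (-(δ * g.dist y y'))))
    (hR' : HasMaj (BlockNorm.ofBlocks g blk) (BlockNorm.ofBlocks g blk) R' (fun y y' => θ * Real.exp (-(δ * g.dist y y'))))
    (hD : HasMaj (BlockNorm.ofBlocks g blk) (BlockNorm.ofBlocks g blk) D (fun y y' => ind Z y * (a₁ * Real.exp (-(δ * g.dist y y')))))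
    (hE : HasMaj (BlockNorm.ofBlocks g blk) (BlockNorm.ofBlocks g blk) E (fun y y' => ind Z y * (θ₁ * Real.exp (-(δ * g.dist y y')))))
    (hq : θ * cr < 1) :
    HasMaj (BlockNorm.ofBlocks g blk) (BlockNorm.ofBlocks g blk) (D ∘ₗ neumannR R + G₀' ∘ₗ neumannR R ∘ₗ E ∘ₗ neumannR R')
      (fun y y' => (a₁ + A * ((1 - θ * cr)⁻¹ * cr) * θ₁ * cr) * ((1 - θ * cr)⁻¹ * cr) * Real.exp (-((δ / 2 - σ) * dZ y)) * Real.exp (-((δ / 2 - 2 * σ) * g.dist y y'))) := by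
  have hκ : (BlockNorm.ofBlocks g blk).κ = 1 := rfl
  have hinv : 0 ≤ (1 - θ * cr)⁻¹ := inv_nonneg.2 (by linarith)
  have hN := hasMaj_neumannR blk htri hd hd0 hrow (ρ := δ - σ) hθ (by linarith) (by linarith) hR hq
  have hN' := hasMaj_neumannR blk htri hd hd0 hrow (ρ := δ - σ) hθ (by linarith) (by linarith) hR' hq
  have h1 := hasMaj_outLoc_comp_exp Z (ρ₁ := δ) (ρ₂ := δ - σ) (ρ := δ - 2 * σ) htri hd hrow ha₁ hinv (by linarith) (by linarith) (by linarith) hD hN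
  have h2a := hasMaj_comp_exp (b₁ := BlockNorm.ofBlocks g blk) (b₂ := BlockNorm.ofBlocks g blk) (b₃ := BlockNorm.ofBlocks g blk) (T₁ := G₀') (T₂ := neumannR R)
    (ρ := δ - 2 * σ) htri hd hrow hA hinv (by linarith) (by linarith) (by linarith) hG₀' hN
  have h2b := hasMaj_outLoc_comp_exp Z (ρ₁ := δ) (ρ₂ := δ - σ) (ρ := δ - 2 * σ) htri hd hrow hθ₁ hinv (by linarith) (by linarith) (by linarith) hE hN'
  have h2 := hasMaj_comp_farOut Z dZ (b₁ := BlockNorm.ofBlocks g blk) (b₂ := BlockNorm.ofBlocks g blk) (b₃ := BlockNorm.ofBlocks g blk) (T₁ := G₀' ∘ₗ neumannR R)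
    (T₂ := E ∘ₗ neumannR R') (ρ₁ := δ - 2 * σ) (ρ₂ := δ - 2 * σ) (ρ := δ / 2 - 2 * σ) htri hd hrow hdZ (by rw [hκ]; positivity) (by rw [hκ]; positivity) (by linarith)
    (by linarith) (by linarith) (by linarith) h2a h2b
  refine ((h1.add h2).congr fun μ => rfl).mono fun y y' => ?_
  rw [hκ]
  have hE1 : Real.exp (-((δ - 2 * σ) * g.dist y y')) ≤ Real.exp (-((δ / 2 - 2 * σ) * g.dist y y')) :=
    Real.exp_le_exp.mpr (by nlinarith [hd y y'])
  have hE2 : Real.exp (-((δ - 2 * σ) / 2 * dZ y)) = Real.exp (-((δ / 2 - σ) * dZ y)) := by ring_nf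
  have hI : ind Z y ≤ Real.exp (-((δ / 2 - σ) * dZ y)) := ind_le_exp_dZ Z dZ hd0 hdZ (by linarith) y
  have hx0 : 0 ≤ Real.exp (-((δ / 2 - σ) * dZ y)) := Real.exp_nonneg _
  have hy0 : 0 ≤ Real.exp (-((δ / 2 - 2 * σ) * g.dist y y')) := Real.exp_nonneg _
  have hz0 : 0 ≤ Real.exp (-((δ - 2 * σ) * g.dist y y')) := Real.exp_nonneg _
  have hc1 : 0 ≤ 1 * a₁ * (1 - θ * cr)⁻¹ * cr := by positivity
  have hc2 : 0 ≤ 1 * (1 * A * (1 - θ * cr)⁻¹ * cr) * (1 * θ₁ * (1 - θ * cr)⁻¹ * cr) * cr := by positivity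
  rw [hE2]
  calc ind Z y * (1 * a₁ * (1 - θ * cr)⁻¹ * cr * Real.exp (-((δ - 2 * σ) * g.dist y y'))) +
        1 * (1 * A * (1 - θ * cr)⁻¹ * cr) * (1 * θ₁ * (1 - θ * cr)⁻¹ * cr) * cr * Real.exp (-((δ / 2 - σ) * dZ y)) * Real.exp (-((δ / 2 - 2 * σ) * g.dist y y'))
      ≤ Real.exp (-((δ / 2 - σ) * dZ y)) * (1 * a₁ * (1 - θ * cr)⁻¹ * cr * Real.exp (-((δ / 2 - 2 * σ) * g.dist y y'))) +
        1 * (1 * A * (1 - θ * cr)⁻¹ * cr) * (1 * θ₁ * (1 - θ * cr)⁻¹ * cr) * cr * Real.exp (-((δ / 2 - σ) * dZ y)) * Real.exp (-((δ / 2 - 2 * σ) * g.dist y y')) := by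
        gcongr
    _ = _ := by ring

/-- ★★★ **WALK LOCALITY WITH CLOSE NEAR DATA**: two parametrix pairs with `G₀♭ ≤ Ae^{−δd}`, `R, R♭ ≤ θe^{−δd}`, `θc_r < 1`, whose differences split as `G₀ − G₀♭ = D_n + D_f`,
`R − R♭ = E_n + E_f` with SMALL near parts `D_n ≤ ε₁e^{−δd}`, `E_n ≤ θ_ne^{−δd}` and OUTPUT-LOCALIZED far parts `D_f ≤ 1_Z(y)·a₁e^{−δd}`, `E_f ≤ 1_Z(y)·θ₁e^{−δd}` ⟹
`glueInv G₀ R − glueInv G₀♭ R♭ ≤ [(ε₁ + AN_cθ_nc_r)N_c + (a₁ + AN_cθ₁c_r)N_c·e^{−(δ∕2−σ)d_Z(y)}]·e^{−(δ∕2−2σ)d}` — every walk of the difference either pays the near closeness or visits `Z`.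
[cite: Balaban1985BackgroundPropagators, Cor. 3.8 (3.93)–(3.94) p.410, Thm 3.14 pp.426–427 (mechanism); Balaban1984PropagatorsII, (2.91) p.239, (2.135)–(2.136) p.247] -/
theorem hasMaj_glueInv_sub_glueInv_near (htri : Triangle254 g) (hd : ∀ a b : g.Site, 0 ≤ g.dist a b) (hd0 : ∀ y : g.Site, g.dist y y = 0) (hrow : RowSum g σ cr) (hσ : 0 ≤ σ)
    (hcr : 0 ≤ cr) (hdZ : ∀ y z, z ∈ Z → dZ y ≤ g.dist y z) {G₀ G₀' R R' Dn Df En Ef : (X → ℝ) →ₗ[ℝ] (X → ℝ)} {A θ ε₁ θn a₁ θ₁ δ : ℝ} (hA : 0 ≤ A) (hθ : 0 ≤ θ)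
    (hε₁ : 0 ≤ ε₁) (hθn : 0 ≤ θn) (ha₁ : 0 ≤ a₁) (hθ₁ : 0 ≤ θ₁) (hσδ : 4 * σ ≤ δ) (hG : G₀ - G₀' = Dn + Df) (hRR : R - R' = En + Ef)
    (hG₀' : HasMaj (BlockNorm.ofBlocks g blk) (BlockNorm.ofBlocks g blk) G₀' (fun y y' => A * Real.exp (-(δ * g.dist y y'))))
    (hR : HasMaj (BlockNorm.ofBlocks g blk) (BlockNorm.ofBlocks g blk) R (fun y y' => θ * Real.exp (-(δ * g.dist y y'))))
    (hR' : HasMaj (BlockNorm.ofBlocks g blk) (BlockNorm.ofBlocks g blk) R' (fun y y' => θ * Real.exp (-(δ * g.dist y y'))))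
    (hDn : HasMaj (BlockNorm.ofBlocks g blk) (BlockNorm.ofBlocks g blk) Dn (fun y y' => ε₁ * Real.exp (-(δ * g.dist y y'))))
    (hEn : HasMaj (BlockNorm.ofBlocks g blk) (BlockNorm.ofBlocks g blk) En (fun y y' => θn * Real.exp (-(δ * g.dist y y'))))
    (hDf : HasMaj (BlockNorm.ofBlocks g blk) (BlockNorm.ofBlocks g blk) Df (fun y y' => ind Z y * (a₁ * Real.exp (-(δ * g.dist y y')))))
    (hEf : HasMaj (BlockNorm.ofBlocks g blk) (BlockNorm.ofBlocks g blk) Ef (fun y y' => ind Z y * (θ₁ * Real.exp (-(δ * g.dist y y')))))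
    (hq : θ * cr < 1) :
    HasMaj (BlockNorm.ofBlocks g blk) (BlockNorm.ofBlocks g blk) (glueInv G₀ R - glueInv G₀' R')
      (fun y y' => ((ε₁ + A * ((1 - θ * cr)⁻¹ * cr) * θn * cr) * ((1 - θ * cr)⁻¹ * cr) +
          (a₁ + A * ((1 - θ * cr)⁻¹ * cr) * θ₁ * cr) * ((1 - θ * cr)⁻¹ * cr) * Real.exp (-((δ / 2 - σ) * dZ y))) *
        Real.exp (-((δ / 2 - 2 * σ) * g.dist y y'))) := by
  have hσδ' : σ ≤ δ := by linarith
  have hunit := isUnit_neumannR blk hd hrow hθ hσδ' hR hq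
  have hunit' := isUnit_neumannR blk hd hrow hθ hσδ' hR' hq
  have hsplit : glueInv G₀ R - glueInv G₀' R' =
      (Dn ∘ₗ neumannR R + G₀' ∘ₗ neumannR R ∘ₗ En ∘ₗ neumannR R') + (Df ∘ₗ neumannR R + G₀' ∘ₗ neumannR R ∘ₗ Ef ∘ₗ neumannR R') := by
    rw [glueInv_sub_glueInv hunit hunit', hG, hRR]
    simp only [LinearMap.add_comp, LinearMap.comp_add]
    abel
  have hn := hasMaj_bracket_near blk htri hd hd0 hrow hσ hcr hA hθ hε₁ hθn hσδ hG₀' hR hR' hDn hEn hq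
  have hf := hasMaj_bracket_far blk Z dZ htri hd hd0 hrow hσ hcr hdZ hA hθ ha₁ hθ₁ hσδ hG₀' hR hR' hDf hEf hq
  rw [hsplit]
  refine (hn.add hf).mono fun y y' => ?_
  have hE1 : Real.exp (-((δ - 3 * σ) * g.dist y y')) ≤ Real.exp (-((δ / 2 - 2 * σ) * g.dist y y')) :=
    Real.exp_le_exp.mpr (by nlinarith [hd y y'])
  have hinv : 0 ≤ (1 - θ * cr)⁻¹ := inv_nonneg.2 (by linarith)
  have hc1 : 0 ≤ (ε₁ + A * ((1 - θ * cr)⁻¹ * cr) * θn * cr) * ((1 - θ * cr)⁻¹ * cr) := by positivity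
  calc (ε₁ + A * ((1 - θ * cr)⁻¹ * cr) * θn * cr) * ((1 - θ * cr)⁻¹ * cr) * Real.exp (-((δ - 3 * σ) * g.dist y y')) +
        (a₁ + A * ((1 - θ * cr)⁻¹ * cr) * θ₁ * cr) * ((1 - θ * cr)⁻¹ * cr) * Real.exp (-((δ / 2 - σ) * dZ y)) * Real.exp (-((δ / 2 - 2 * σ) * g.dist y y'))
      ≤ (ε₁ + A * ((1 - θ * cr)⁻¹ * cr) * θn * cr) * ((1 - θ * cr)⁻¹ * cr) * Real.exp (-((δ / 2 - 2 * σ) * g.dist y y')) +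
        (a₁ + A * ((1 - θ * cr)⁻¹ * cr) * θ₁ * cr) * ((1 - θ * cr)⁻¹ * cr) * Real.exp (-((δ / 2 - σ) * dZ y)) * Real.exp (-((δ / 2 - 2 * σ) * g.dist y y')) := by
        gcongr
    _ = _ := by ring

end Locality

/-! ## §2 Cube editions: pieces close off the far cubes -/

section Pieces

variable {X : Type} [Fintype X] [DecidableEq X] {ι : Type} [Fintype ι] {g : B6.Geometry} (blk : X → g.Site) (S : ι → Set g.Site) (Far : ι → Prop) [DecidablePred Far]
  (Z : Set g.Site) (dZ : g.Site → ℝ) {σ cr : ℝ}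

omit [DecidableEq X] in
/-- A sum of two-sided cube-localized pieces, vanishing on the far cubes, has a plain overlap row: `Σ_□ D_□ ≤ N_ov·ε·e^{−δd}` when `D_□ ≤ 1_{S_□}1_{S_□}·εe^{−δd}` (near) and
`D_□ = 0` (far). [folklore] -/
theorem hasMaj_sum_near {Nov : ℝ} (hN : ∀ a, ∑ i, ind (S i) a ≤ Nov) {D : ι → (X → ℝ) →ₗ[ℝ] (X → ℝ)} {ε δ : ℝ} (hε : 0 ≤ ε)
    (hD : ∀ i, ¬Far i → HasMaj (BlockNorm.ofBlocks g blk) (BlockNorm.ofBlocks g blk) (D i) (fun y y' => ind (S i) y * ind (S i) y' * (ε * Real.exp (-(δ * g.dist y y')))))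
    (hD0 : ∀ i, Far i → D i = 0) :
    HasMaj (BlockNorm.ofBlocks g blk) (BlockNorm.ofBlocks g blk) (∑ i, D i) (fun y y' => Nov * ε * Real.exp (-(δ * g.dist y y'))) := by
  have hterm : ∀ i, HasMaj (BlockNorm.ofBlocks g blk) (BlockNorm.ofBlocks g blk) (D i) (fun y y' => ind (S i) y * (ε * Real.exp (-(δ * g.dist y y')))) := by
    intro i
    by_cases hi : Far i
    · rw [hD0 i hi]
      exact (hasMaj_zero _ _).mono fun y y' => mul_nonneg (ind_nonneg _ _) (mul_nonneg hε (Real.exp_nonneg _))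
    · refine (hD i hi).mono fun y y' => ?_
      have hE : 0 ≤ ind (S i) y * (ε * Real.exp (-(δ * g.dist y y'))) := mul_nonneg (ind_nonneg _ _) (mul_nonneg hε (Real.exp_nonneg _))
      calc ind (S i) y * ind (S i) y' * (ε * Real.exp (-(δ * g.dist y y'))) = ind (S i) y' * (ind (S i) y * (ε * Real.exp (-(δ * g.dist y y')))) := by ring
        _ ≤ 1 * (ind (S i) y * (ε * Real.exp (-(δ * g.dist y y')))) := mul_le_mul_of_nonneg_right (ind_le_one _ _) hE
        _ = _ := one_mul _
  refine (hasMaj_sum_overlap _ S _ Nov (fun y y' => mul_nonneg hε (Real.exp_nonneg _)) hterm hN).mono fun y y' => le_of_eq (by ring)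

/-- ★★★ **WALK LOCALITY WITH CLOSE CUBE PIECES**: `G₀ = Σ_□P_□`, `R = Σ_□Q_□`, `G₀♭ = Σ_□P♭_□`, `R♭ = Σ_□Q♭_□` with the (2.133)∕(2.134)-shaped rows (`β`, `θ₀`), overlap `N_ov`,
`N_ovθ₀c_r < 1`, `4σ ≤ δ`; on the cubes NOT `Far` the pieces are CLOSE — `P_□ − P♭_□ ≤ 1_S1_S·ε_Pe^{−δd}`, `Q_□ − Q♭_□ ≤ 1_S1_S·ε_Qe^{−δd}` — and `S_□ ⊆ Z` on the far cubes.  Then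
`glueInv G₀ R − glueInv G₀♭ R♭ ≤ [(N_ovε_P + N_ovβ·N_c·N_ovε_Q·c_r)N_c + (2N_ovβ + N_ovβ·N_c·2N_ovθ₀·c_r)N_c·e^{−(δ∕2−σ)d_Z(y)}]·e^{−(δ∕2−2σ)d}`, `N_c = (1 − N_ovθ₀c_r)⁻¹c_r`.
[cite: Balaban1985BackgroundPropagators, Cor. 3.8 (3.94) p.410, Thm 3.14 pp.426–427 (mechanism); Balaban1984PropagatorsII, (2.133)–(2.136) p.247] -/
theorem hasMaj_glueInv_sub_glueInv_of_close_pieces (htri : Triangle254 g) (hd : ∀ a b : g.Site, 0 ≤ g.dist a b) (hd0 : ∀ y : g.Site, g.dist y y = 0) (hrow : RowSum g σ cr)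
    (hσ : 0 ≤ σ) (hcr : 0 ≤ cr) (hdZ : ∀ y z, z ∈ Z → dZ y ≤ g.dist y z) {Nov : ℝ} (hN : ∀ a, ∑ i, ind (S i) a ≤ Nov) (hNov : 0 ≤ Nov) (hZ : ∀ i, Far i → S i ⊆ Z)
    {P P' Q Q' : ι → (X → ℝ) →ₗ[ℝ] (X → ℝ)} {β θ₀ εP εQ δ : ℝ} (hβ : 0 ≤ β) (hθ : 0 ≤ θ₀) (hεP : 0 ≤ εP) (hεQ : 0 ≤ εQ) (hσδ : 4 * σ ≤ δ)
    (hP : ∀ i, HasMaj (BlockNorm.ofBlocks g blk) (BlockNorm.ofBlocks g blk) (P i) (fun y y' => ind (S i) y * ind (S i) y' * (β * Real.exp (-(δ * g.dist y y')))))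
    (hP' : ∀ i, HasMaj (BlockNorm.ofBlocks g blk) (BlockNorm.ofBlocks g blk) (P' i) (fun y y' => ind (S i) y * ind (S i) y' * (β * Real.exp (-(δ * g.dist y y')))))
    (hQ : ∀ i, HasMaj (BlockNorm.ofBlocks g blk) (BlockNorm.ofBlocks g blk) (Q i) (fun y y' => ind (S i) y * ind (S i) y' * (θ₀ * Real.exp (-(δ * g.dist y y')))))
    (hQ' : ∀ i, HasMaj (BlockNorm.ofBlocks g blk) (BlockNorm.ofBlocks g blk) (Q' i) (fun y y' => ind (S i) y * ind (S i) y' * (θ₀ * Real.exp (-(δ * g.dist y y')))))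
    (hPP' : ∀ i, ¬Far i → HasMaj (BlockNorm.ofBlocks g blk) (BlockNorm.ofBlocks g blk) (P i - P' i) (fun y y' => ind (S i) y * ind (S i) y' * (εP * Real.exp (-(δ * g.dist y y')))))
    (hQQ' : ∀ i, ¬Far i → HasMaj (BlockNorm.ofBlocks g blk) (BlockNorm.ofBlocks g blk) (Q i - Q' i) (fun y y' => ind (S i) y * ind (S i) y' * (εQ * Real.exp (-(δ * g.dist y y')))))
    (hq : Nov * θ₀ * cr < 1) :
    HasMaj (BlockNorm.ofBlocks g blk) (BlockNorm.ofBlocks g blk) (glueInv (∑ i, P i) (∑ i, Q i) - glueInv (∑ i, P' i) (∑ i, Q' i))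
      (fun y y' => ((Nov * εP + Nov * β * ((1 - Nov * θ₀ * cr)⁻¹ * cr) * (Nov * εQ) * cr) * ((1 - Nov * θ₀ * cr)⁻¹ * cr) +
          (Nov * (2 * β) + Nov * β * ((1 - Nov * θ₀ * cr)⁻¹ * cr) * (Nov * (2 * θ₀)) * cr) * ((1 - Nov * θ₀ * cr)⁻¹ * cr) * Real.exp (-((δ / 2 - σ) * dZ y))) *
        Real.exp (-((δ / 2 - 2 * σ) * g.dist y y'))) := by
  classical
  -- one-indicator rows from two-indicator rows
  have one_of_two : ∀ {c : ℝ}, 0 ≤ c → ∀ {T : (X → ℝ) →ₗ[ℝ] (X → ℝ)} (i : ι),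
      HasMaj (BlockNorm.ofBlocks g blk) (BlockNorm.ofBlocks g blk) T (fun y y' => ind (S i) y * ind (S i) y' * (c * Real.exp (-(δ * g.dist y y')))) →
      HasMaj (BlockNorm.ofBlocks g blk) (BlockNorm.ofBlocks g blk) T (fun y y' => ind (S i) y * (c * Real.exp (-(δ * g.dist y y')))) := by
    intro c hc T i hT
    refine hT.mono fun y y' => ?_
    have hE : 0 ≤ ind (S i) y * (c * Real.exp (-(δ * g.dist y y'))) := mul_nonneg (ind_nonneg _ _) (mul_nonneg hc (Real.exp_nonneg _))
    calc ind (S i) y * ind (S i) y' * (c * Real.exp (-(δ * g.dist y y'))) = ind (S i) y' * (ind (S i) y * (c * Real.exp (-(δ * g.dist y y')))) := by ring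
      _ ≤ 1 * (ind (S i) y * (c * Real.exp (-(δ * g.dist y y')))) := mul_le_mul_of_nonneg_right (ind_le_one _ _) hE
      _ = _ := one_mul _
  -- global rows of the primed parametrix and of the two remainders
  have hsumP' : HasMaj (BlockNorm.ofBlocks g blk) (BlockNorm.ofBlocks g blk) (∑ i, P' i) (fun y y' => Nov * β * Real.exp (-(δ * g.dist y y'))) :=
    (hasMaj_sum_overlap _ S _ Nov (fun y y' => mul_nonneg hβ (Real.exp_nonneg _)) (fun i => one_of_two hβ i (hP' i)) hN).mono fun y y' => le_of_eq (by ring)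
  have hsumQ : ∀ {Qx : ι → (X → ℝ) →ₗ[ℝ] (X → ℝ)}, (∀ i, HasMaj (BlockNorm.ofBlocks g blk) (BlockNorm.ofBlocks g blk) (Qx i) (fun y y' => ind (S i) y * ind (S i) y' * (θ₀ * Real.exp (-(δ * g.dist y y'))))) →
      HasMaj (BlockNorm.ofBlocks g blk) (BlockNorm.ofBlocks g blk) (∑ i, Qx i) (fun y y' => Nov * θ₀ * Real.exp (-(δ * g.dist y y'))) := fun hQx =>
    (hasMaj_sum_overlap _ S _ Nov (fun y y' => mul_nonneg hθ (Real.exp_nonneg _)) (fun i => one_of_two hθ i (hQx i)) hN).mono fun y y' => le_of_eq (by ring)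
  -- the near ∕ far splits of the differences
  set Dn : (X → ℝ) →ₗ[ℝ] (X → ℝ) := ∑ i, if Far i then 0 else P i - P' i with hDn
  set Df : (X → ℝ) →ₗ[ℝ] (X → ℝ) := ∑ i, if Far i then P i - P' i else 0 with hDf
  set En : (X → ℝ) →ₗ[ℝ] (X → ℝ) := ∑ i, if Far i then 0 else Q i - Q' i with hEn
  set Ef : (X → ℝ) →ₗ[ℝ] (X → ℝ) := ∑ i, if Far i then Q i - Q' i else 0 with hEf
  have hsplitP : ∑ i, P i - ∑ i, P' i = Dn + Df := by
    rw [hDn, hDf, ← Finset.sum_sub_distrib, ← Finset.sum_add_distrib]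
    exact Finset.sum_congr rfl fun i _ => by split_ifs <;> simp
  have hsplitQ : ∑ i, Q i - ∑ i, Q' i = En + Ef := by
    rw [hEn, hEf, ← Finset.sum_sub_distrib, ← Finset.sum_add_distrib]
    exact Finset.sum_congr rfl fun i _ => by split_ifs <;> simp
  have hDn' : HasMaj (BlockNorm.ofBlocks g blk) (BlockNorm.ofBlocks g blk) Dn (fun y y' => Nov * εP * Real.exp (-(δ * g.dist y y'))) := by
    refine hasMaj_sum_near blk S Far hN (D := fun i => if Far i then 0 else P i - P' i) hεP (fun i hi => ?_) (fun i hi => by simp only [if_pos hi])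
    simp only [if_neg hi]; exact hPP' i hi
  have hEn' : HasMaj (BlockNorm.ofBlocks g blk) (BlockNorm.ofBlocks g blk) En (fun y y' => Nov * εQ * Real.exp (-(δ * g.dist y y'))) := by
    refine hasMaj_sum_near blk S Far hN (D := fun i => if Far i then 0 else Q i - Q' i) hεQ (fun i hi => ?_) (fun i hi => by simp only [if_pos hi])
    simp only [if_neg hi]; exact hQQ' i hi
  have hDf' : HasMaj (BlockNorm.ofBlocks g blk) (BlockNorm.ofBlocks g blk) Df (fun y y' => ind Z y * (Nov * (2 * β) * Real.exp (-(δ * g.dist y y')))) := by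
    refine hasMaj_sum_far blk S Far Z hN hZ (D := fun i => if Far i then P i - P' i else 0) (c := 2 * β) (δ := δ) (by positivity) (fun i => ?_) (fun i hi => by simp only [if_neg hi])
    by_cases hi : Far i
    · simp only [if_pos hi]; exact ((hP i).sub (hP' i)).mono fun y y' => le_of_eq (by ring)
    · simp only [if_neg hi]; exact (hasMaj_zero _ _).mono fun y y' => mul_nonneg (mul_nonneg (ind_nonneg _ _) (ind_nonneg _ _)) (by positivity)
  have hEf' : HasMaj (BlockNorm.ofBlocks g blk) (BlockNorm.ofBlocks g blk) Ef (fun y y' => ind Z y * (Nov * (2 * θ₀) * Real.exp (-(δ * g.dist y y')))) := by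
    refine hasMaj_sum_far blk S Far Z hN hZ (D := fun i => if Far i then Q i - Q' i else 0) (c := 2 * θ₀) (δ := δ) (by positivity) (fun i => ?_) (fun i hi => by simp only [if_neg hi])
    by_cases hi : Far i
    · simp only [if_pos hi]; exact ((hQ i).sub (hQ' i)).mono fun y y' => le_of_eq (by ring)
    · simp only [if_neg hi]; exact (hasMaj_zero _ _).mono fun y y' => mul_nonneg (mul_nonneg (ind_nonneg _ _) (ind_nonneg _ _)) (by positivity)
  exact hasMaj_glueInv_sub_glueInv_near blk Z dZ htri hd hd0 hrow hσ hcr hdZ (mul_nonneg hNov hβ) (mul_nonneg hNov hθ) (by positivity) (by positivity) (by positivity) (by positivity)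
    hσδ hsplitP hsplitQ hsumP' (hsumQ hQ) (hsumQ hQ') hDn' hEn' hDf' hEf' hq

/-- ★★ **WALK LOCALITY FOR CUBE PAIRS WITH CLOSE NEAR DATA**: two families of cube propagators `G_□, G♭_□` with partitions `h`, operators `Δ, Δ♭`, the (2.133)∕(2.134)-shaped rows for
both, `|h_□| ≤ 1`, overlap `N_ov`, `N_ovθ₀c_r < 1`, `4σ ≤ δ`; off the far cubes the propagators are `ε_G`-CLOSE and the commutator pieces `[Δ, M_{h_□}]G_□`, `[Δ♭, M_{h_□}]G♭_□` are
`ε_K`-CLOSE (two-sided cube-localized rows); `S_□ ⊆ Z` on the far cubes ⟹ the glued propagators differ by `≤ [C_near + C_far·e^{−(δ∕2−σ)d_Z(y)}]·e^{−(δ∕2−2σ)d}` with §2's constants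
(`ε_P = ε_G`, `ε_Q = ε_K`). [cite: Balaban1985BackgroundPropagators, Thm 3.14 pp.426–427, Cor. 3.8 p.410 (mechanism)] -/
theorem hasMaj_glued_sub_glued_of_close_cubes (htri : Triangle254 g) (hd : ∀ a b : g.Site, 0 ≤ g.dist a b) (hd0 : ∀ y : g.Site, g.dist y y = 0) (hrow : RowSum g σ cr) (hσ : 0 ≤ σ)
    (hcr : 0 ≤ cr) (hdZ : ∀ y z, z ∈ Z → dZ y ≤ g.dist y z) {Nov : ℝ} (hN : ∀ a, ∑ i, ind (S i) a ≤ Nov) (hNov : 0 ≤ Nov) (hZ : ∀ i, Far i → S i ⊆ Z)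
    {Δ Δ' : (X → ℝ) →ₗ[ℝ] (X → ℝ)} {h : ι → X → ℝ} {G G' : ι → (X → ℝ) →ₗ[ℝ] (X → ℝ)} {β θ₀ εG εK δ : ℝ} (hβ : 0 ≤ β) (hθ : 0 ≤ θ₀) (hεG : 0 ≤ εG) (hεK : 0 ≤ εK)
    (hσδ : 4 * σ ≤ δ) (hh : ∀ i x, |h i x| ≤ 1)
    (hG : ∀ i, HasMaj (BlockNorm.ofBlocks g blk) (BlockNorm.ofBlocks g blk) (G i) (fun y y' => ind (S i) y * ind (S i) y' * (β * Real.exp (-(δ * g.dist y y')))))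
    (hG' : ∀ i, HasMaj (BlockNorm.ofBlocks g blk) (BlockNorm.ofBlocks g blk) (G' i) (fun y y' => ind (S i) y * ind (S i) y' * (β * Real.exp (-(δ * g.dist y y')))))
    (hK : ∀ i, HasMaj (BlockNorm.ofBlocks g blk) (BlockNorm.ofBlocks g blk) (commOp Δ (h i) ∘ₗ G i) (fun y y' => ind (S i) y * ind (S i) y' * (θ₀ * Real.exp (-(δ * g.dist y y')))))
    (hK' : ∀ i, HasMaj (BlockNorm.ofBlocks g blk) (BlockNorm.ofBlocks g blk) (commOp Δ' (h i) ∘ₗ G' i) (fun y y' => ind (S i) y * ind (S i) y' * (θ₀ * Real.exp (-(δ * g.dist y y')))))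
    (hGG' : ∀ i, ¬Far i → HasMaj (BlockNorm.ofBlocks g blk) (BlockNorm.ofBlocks g blk) (G i - G' i) (fun y y' => ind (S i) y * ind (S i) y' * (εG * Real.exp (-(δ * g.dist y y')))))
    (hKK' : ∀ i, ¬Far i → HasMaj (BlockNorm.ofBlocks g blk) (BlockNorm.ofBlocks g blk) (commOp Δ (h i) ∘ₗ G i - commOp Δ' (h i) ∘ₗ G' i)
      (fun y y' => ind (S i) y * ind (S i) y' * (εK * Real.exp (-(δ * g.dist y y')))))
    (hq : Nov * θ₀ * cr < 1) :
    HasMaj (BlockNorm.ofBlocks g blk) (BlockNorm.ofBlocks g blk)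
      (glueInv (parametrix h G) (remainder Δ h G) - glueInv (parametrix h G') (remainder Δ' h G'))
      (fun y y' => ((Nov * εG + Nov * β * ((1 - Nov * θ₀ * cr)⁻¹ * cr) * (Nov * εK) * cr) * ((1 - Nov * θ₀ * cr)⁻¹ * cr) +
          (Nov * (2 * β) + Nov * β * ((1 - Nov * θ₀ * cr)⁻¹ * cr) * (Nov * (2 * θ₀)) * cr) * ((1 - Nov * θ₀ * cr)⁻¹ * cr) * Real.exp (-((δ / 2 - σ) * dZ y))) *
        Real.exp (-((δ / 2 - 2 * σ) * g.dist y y'))) := by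
  have hnn : ∀ {c : ℝ}, 0 ≤ c → ∀ (i : ι) (y y' : g.Site), 0 ≤ ind (S i) y * ind (S i) y' * (c * Real.exp (-(δ * g.dist y y'))) := fun hc i y y' =>
    mul_nonneg (mul_nonneg (ind_nonneg _ _) (ind_nonneg _ _)) (mul_nonneg hc (Real.exp_nonneg _))
  -- the pieces: `P_□ = M_hG_□M_h`, `Q_□ = −[Δ, M_h]G_□M_h`, and their differences
  have hPx : ∀ {c : ℝ}, 0 ≤ c → ∀ (i : ι) {T : (X → ℝ) →ₗ[ℝ] (X → ℝ)},
      HasMaj (BlockNorm.ofBlocks g blk) (BlockNorm.ofBlocks g blk) T (fun y y' => ind (S i) y * ind (S i) y' * (c * Real.exp (-(δ * g.dist y y')))) →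
      HasMaj (BlockNorm.ofBlocks g blk) (BlockNorm.ofBlocks g blk) (mulOp (h i) ∘ₗ T ∘ₗ mulOp (h i)) (fun y y' => ind (S i) y * ind (S i) y' * (c * Real.exp (-(δ * g.dist y y')))) :=
    fun hc i T hT => hasMaj_mulOp_sandwich blk (hnn hc i) (hh i) (hh i) hT
  have hQx : ∀ {c : ℝ}, 0 ≤ c → ∀ (i : ι) {T : (X → ℝ) →ₗ[ℝ] (X → ℝ)},
      HasMaj (BlockNorm.ofBlocks g blk) (BlockNorm.ofBlocks g blk) T (fun y y' => ind (S i) y * ind (S i) y' * (c * Real.exp (-(δ * g.dist y y')))) →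
      HasMaj (BlockNorm.ofBlocks g blk) (BlockNorm.ofBlocks g blk) (-(T ∘ₗ mulOp (h i))) (fun y y' => ind (S i) y * ind (S i) y' * (c * Real.exp (-(δ * g.dist y y')))) := by
    intro c hc i T hT
    have hMb := hasMaj_mulOp (g := g) blk (m := fun _ => (1 : ℝ)) (fun _ => zero_le_one) (hh i)
    exact ((hasMaj_comp_diag blk (hnn hc i) hT hMb).neg).mono fun y y' => le_of_eq (by ring)
  have hpar : ∀ (Gx : ι → (X → ℝ) →ₗ[ℝ] (X → ℝ)), parametrix h Gx = ∑ i, mulOp (h i) ∘ₗ Gx i ∘ₗ mulOp (h i) := fun _ => rfl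
  have hrem : ∀ (Δx : (X → ℝ) →ₗ[ℝ] (X → ℝ)) (Gx : ι → (X → ℝ) →ₗ[ℝ] (X → ℝ)), remainder Δx h Gx = ∑ i, -((commOp Δx (h i) ∘ₗ Gx i) ∘ₗ mulOp (h i)) := by
    intro Δx Gx
    rw [remainder, ← Finset.sum_neg_distrib]
    exact Finset.sum_congr rfl fun i _ => by rw [LinearMap.comp_assoc]
  rw [hpar G, hpar G', hrem Δ G, hrem Δ' G']
  refine hasMaj_glueInv_sub_glueInv_of_close_pieces blk S Far Z dZ htri hd hd0 hrow hσ hcr hdZ hN hNov hZ hβ hθ hεG hεK hσδ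
    (P := fun i => mulOp (h i) ∘ₗ G i ∘ₗ mulOp (h i)) (P' := fun i => mulOp (h i) ∘ₗ G' i ∘ₗ mulOp (h i))
    (Q := fun i => -((commOp Δ (h i) ∘ₗ G i) ∘ₗ mulOp (h i))) (Q' := fun i => -((commOp Δ' (h i) ∘ₗ G' i) ∘ₗ mulOp (h i)))
    (fun i => hPx hβ i (hG i)) (fun i => hPx hβ i (hG' i)) (fun i => hQx hθ i (hK i)) (fun i => hQx hθ i (hK' i)) (fun i hi => ?_) (fun i hi => ?_) hq
  · have e : mulOp (h i) ∘ₗ G i ∘ₗ mulOp (h i) - mulOp (h i) ∘ₗ G' i ∘ₗ mulOp (h i) = mulOp (h i) ∘ₗ (G i - G' i) ∘ₗ mulOp (h i) := by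
      rw [LinearMap.sub_comp, LinearMap.comp_sub]
    rw [e]
    exact hPx hεG i (hGG' i hi)
  · have e : -((commOp Δ (h i) ∘ₗ G i) ∘ₗ mulOp (h i)) - -((commOp Δ' (h i) ∘ₗ G' i) ∘ₗ mulOp (h i)) =
        -((commOp Δ (h i) ∘ₗ G i - commOp Δ' (h i) ∘ₗ G' i) ∘ₗ mulOp (h i)) := by
      rw [LinearMap.sub_comp]; abel
    rw [e]
    exact hQx hεK i (hKK' i hi)

end Pieces

end Summit.QuantumFields.YangMills.BalabanUVNodes.N15.Gluing

end
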